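import Literature.AlgebraicGeometry.Frobenioids.ArchimedeanQuasiIsotropic
import Literature.AlgebraicGeometry.Frobenioids.ArchimedeanProp35iiCounterexampleAngular
import HarnessLib

/-!
# Frobenioids II, Proposition 3.5 (ii) for `C` and `A`: the EXACT use of «`D` totally epimorphic» —
# PROVED under the weaker hypothesis «split monomorphisms of `D` are invertible», which is SHARP

Mochizuki, *The geometry of Frobenioids II: poly-Frobenioids*, Kyushu J. Math. **62** (2008) 401–460,
§3, Proposition 3.5 (ii), kurims p. 34 [cite: MochizukiFrdII2008, Prop 3.5 (ii) p.34] ("The Frobenioid `F`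
is quasi-isotropic, i.e., an object of `F` is non-isotropic if and only if it is an iso-subanchor of `F`",
`F = C, A` of Example 3.3 over a connected, TOTALLY EPIMORPHIC base `D → D₀` of RC-iso-subanchor type) and
[FrdI] Rmk. 3.1.1 ("an anchor is never isotropic … an iso-subanchor … is never isotropic")
[cite: MochizukiFrdI2008, Rmk. 3.1.1].

PROOF-ONLY companion (seat abc-iut-f-014, block F, FACT-LIST rows F-0861/F-0862; no definitions). In the
tree the typed instances `ArchFrd.Prop35ii_C π` / `ArchFrd.Prop35ii_A π` are PROVED under the printed
standing hypothesis (`ArchFrd.prop35ii_C/_A (hTE : IsTotallyEpimorphic D)`, abc-iut-w4-d092,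
`ArchimedeanQuasiIsotropic.lean`) and their universal closures over ALL bases are REFUTED
(`P35iiToy.not_prop35ii_C/_A`, `ArchimedeanProp35iiCounterexampleAngular.lean`; `ArchFrd.not_prop35ii_C_retract`,
abc-iut-w4-d092). This file locates the dependence EXACTLY. The ONLY place where total epimorphicity of `D`
enters the «iso-subanchor ⇒ non-isotropic» half is `ArchFrd.isIso_or_isIso_of_fac_frobHom`
(`ArchimedeanIsotropicAnchors.lean`): in a factorisation `X → W → X^{(p)}` of a prime-degree Frobenius arrow
the `D`-part of the first factor is a SPLIT MONOMORPHISM, made invertible by «split mono + epi ⇒ iso».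
Hence:

* `isIso_or_isIso_of_fac_frobHom_of_splitMono` — the same conclusion under
  `hD : ∀ s, IsSplitMono s → IsIso s` («split monomorphisms of `D` are invertible»), obtained WITHOUT
  re-running the analytic argument: push the factorisation along `π` to `C` over `𝟭 D₀` (`D₀` IS totally
  epimorphic, `D0.isTotallyEpimorphic`) to decide the `C₀`-parts, and use `hD` for the `D`-parts;
* `not_isAnchor_of_isotropic_of_splitMono` (and `A.…`) — isotropic objects are not anchors;
  **`prop35ii_C_of_splitMono`**, **`prop35ii_A_of_splitMono`** — Prop. 3.5 (ii) for `C` and `A` over EVERY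
  base of RC-iso-subanchor type whose split monomorphisms are invertible (strictly weaker than totally
  epimorphic: `prop35ii_C/_A` are recovered, `splitMono_isIso_of_isTotallyEpimorphic`);
* **`prop35ii_splitMono_dichotomy`** — SHARPNESS: together with the counterexample base `T` of
  `ArchimedeanProp35iiToyBase.lean` (connected, of RC-iso-subanchor type, with ONE non-invertible split
  monomorphism `pt → pt ⊔ pt`, `P35iiToy.T.isSplitMono_sec` / `T.not_isIso_sec`) over which both instances
  fail: invertibility of split monomorphisms of the base is exactly what the typed Prop. 3.5 (ii) needs.

No statement of the paper is strengthened or weakened (print assumes `D` totally epimorphic throughout);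
this concerns OUR typed rows F-0861/F-0862 (instance forms under the weakest sufficient hypothesis, R5).
Nothing here bears on [IUTchIII] Cor. 3.12; typed ≠ proved except where a `theorem` says so.
-/

namespace Literature.AlgebraicGeometry.Frobenioids

open CategoryTheory

noncomputable section

universe v u

namespace ArchFrd

variable {D : Type u} [Category.{v} D] (π : D ⥤ D0)

/-! ### Frobenius arrows of prime degree are irreducible once split monomorphisms of `D` are invertible -/

/-- In a totally epimorphic category every split monomorphism is an isomorphism (so the hypothesis used
below is implied by Example 3.3's standing hypothesis). [cite: MochizukiFrdI2008, §0 p.18] -/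
theorem splitMono_isIso_of_isTotallyEpimorphic {T : Type u} [Category.{v} T] (hTE : IsTotallyEpimorphic T)
    ⦃a b : T⦄ (s : a ⟶ b) (hs : IsSplitMono s) : IsIso s := by
  haveI := hs
  haveI : Epi s := hTE.epi s
  exact isIso_of_epi_of_isSplitMono s

/-- **`ArchFrd.isIso_or_isIso_of_fac_frobHom` under the weaker hypothesis «split monomorphisms of `D` are
invertible»**: in a factorisation `X → W → X^{(p)}` (`X` naively isotropic, `p` prime) one factor is an
isomorphism. The `D`-part of the first factor is a split monomorphism, hence invertible by `hD`; the
`C₀`-parts are decided by the totally epimorphic case applied over the base `𝟭 D₀` after pushing the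
factorisation along `π`. [cite: MochizukiFrdII2008, Prop 3.5 (ii) p.34] -/
theorem isIso_or_isIso_of_fac_frobHom_of_splitMono
    (hD : ∀ ⦃a b : D⦄ (s : a ⟶ b), IsSplitMono s → IsIso s) {X W : C π}
    (hX : X.fst.IsNaivelyIsotropic) (p : ℕ+) (hp : (p : ℕ).Prime) (β : X ⟶ W) (α : W ⟶ frobObj π X p)
    (h : β ≫ α = frobHom π X p) : IsIso α ∨ IsIso β := by
  -- `D`-parts
  have hsnd : β.snd ≫ α.snd = 𝟙 X.snd := congrArg CFP.Hom.snd h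
  haveI : IsIso β.snd := hD β.snd (IsSplitMono.mk' ⟨α.snd, hsnd⟩)
  haveI : IsIso (β.snd ≫ α.snd) := by rw [hsnd]; infer_instance
  haveI : IsIso α.snd := IsIso.of_isIso_comp_left β.snd α.snd
  -- `C₀`-parts: push down to the base `𝟭 D₀`
  let X' : C (𝟭 D0) := ⟨X.fst, π.obj X.snd, X.iso⟩
  let W' : C (𝟭 D0) := ⟨W.fst, π.obj W.snd, W.iso⟩
  let β' : X' ⟶ W' := ⟨β.fst, π.map β.snd, β.w⟩
  let α' : W' ⟶ frobObj (𝟭 D0) X' p := ⟨α.fst, π.map α.snd, α.w⟩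
  have hfst : β.fst ≫ α.fst = (frobHom π X p).fst := congrArg CFP.Hom.fst h
  have h' : β' ≫ α' = frobHom (𝟭 D0) X' p := by
    refine CFP.hom_ext ?_ ?_
    · exact hfst
    · change π.map β.snd ≫ π.map α.snd = 𝟙 (π.obj X.snd)
      rw [← π.map_comp, hsnd, π.map_id]
  rcases isIso_or_isIso_of_fac_frobHom (𝟭 D0) D0.isTotallyEpimorphic hX p hp β' α' h' with hα | hβ
  · haveI : IsIso α.fst := CFP.isIso_fst α'
    exact Or.inl (CFP.isIso_of_isIso_fst_snd α)
  · haveI : IsIso β.fst := CFP.isIso_fst β'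
    exact Or.inr (CFP.isIso_of_isIso_fst_snd β)

/-- Irreducibility in `C` of the prime-degree Frobenius arrows out of naively isotropic objects, over a
base whose split monomorphisms are invertible. [cite: MochizukiFrdII2008, Prop 3.5 (ii) p.34] -/
theorem isIrreducibleHom_frobHom_of_splitMono (hD : ∀ ⦃a b : D⦄ (s : a ⟶ b), IsSplitMono s → IsIso s)
    (X : C π) (hX : X.fst.IsNaivelyIsotropic) (p : ℕ+) (hp : (p : ℕ).Prime) :
    IsIrreducibleHom (frobHom π X p) :=
  ⟨not_isIso_frobHom π X p (fun h1 => hp.ne_one (by rw [h1]; rfl)),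
    fun _ β α h => isIso_or_isIso_of_fac_frobHom_of_splitMono π hD hX p hp β α h⟩

/-! ### `F = C` -/

/-- **[FrdI] Prop. 1.10 (iv) for `C` over a base whose split monomorphisms are invertible**: an object with
naively isotropic region is not an anchor (infinitely many classes of irreducible prime-Frobenius arrows;
adapted from `ArchFrd.not_isAnchor_of_isotropic`, abc-iut-L1). [cite: MochizukiFrdII2008, Prop 3.5 (ii) p.34] -/
theorem not_isAnchor_of_isotropic_of_splitMono (hD : ∀ ⦃a b : D⦄ (s : a ⟶ b), IsSplitMono s → IsIso s)
    (X : C π) (hX : X.fst.IsNaivelyIsotropic) : ¬ IsAnchor X := by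
  intro hfin
  let P : ℕ → ℕ+ := fun n => ⟨Nat.nth Nat.Prime n, (Nat.prime_nth_prime n).pos⟩
  have hP : ∀ n, ((P n : ℕ+) : ℕ).Prime := fun n => Nat.prime_nth_prime n
  let g : ℕ → Quotient (isIsomorphicSetoid (Under X)) :=
    fun n => Quotient.mk _ (Under.mk (frobHom π X (P n)))
  have hg : Function.Injective g := by
    intro m n hmn
    obtain ⟨e⟩ := Quotient.exact hmn
    have hPmn : P m = P n := eq_of_under_iso_C π X (hP m) (hP n) e
    have : Nat.nth Nat.Prime m = Nat.nth Nat.Prime n := congrArg (fun k : ℕ+ => (k : ℕ)) hPmn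
    exact Nat.nth_injective Nat.infinite_setOf_prime this
  refine Set.infinite_of_injective_forall_mem hg (fun n => ?_) hfin
  exact ⟨Under.mk (frobHom π X (P n)), isIrreducibleHom_frobHom_of_splitMono π hD X hX (P n) (hP n), rfl⟩

/-- **[FrdI] Rmk. 3.1.1 for `C`** over such a base: an iso-subanchor has non-isotropic region.
[cite: MochizukiFrdII2008, Prop 3.5 (ii) p.34] -/
theorem not_isNaivelyIsotropic_of_isIsoSubanchor_of_splitMono
    (hD : ∀ ⦃a b : D⦄ (s : a ⟶ b), IsSplitMono s → IsIso s) (A : C π) (h : IsIsoSubanchor A) :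
    ¬ A.fst.IsNaivelyIsotropic := by
  obtain ⟨B, G, f, ⟨B', hB', ⟨g⟩⟩, hf⟩ := h
  intro hA
  have hB : B.fst.IsNaivelyIsotropic := isNaivelyIsotropic_of_monoMinimalQuotient π G f hf hA
  exact not_isAnchor_of_isotropic_of_splitMono π hD B' (C0.isNaivelyIsotropic_of_hom g.fst hB) hB'

/-- Prop. 3.5 (ii) for `C`, direction «iso-subanchor ⇒ non-isotropic», over a base whose split
monomorphisms are invertible. [cite: MochizukiFrdII2008, Prop 3.5 (ii) p.34] -/
theorem isoSubanchor_not_isotropic_C_of_splitMono (hD : ∀ ⦃a b : D⦄ (s : a ⟶ b), IsSplitMono s → IsIso s)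
    (A : C π) (h : IsIsoSubanchor A) : ¬ PreFrobenioid.IsIsotropic (C.toElem π) A :=
  fun hA => not_isNaivelyIsotropic_of_isIsoSubanchor_of_splitMono π hD A h
    ((Ex33ii_isotropic_iff_holds π A).1 hA)

/-- **Proposition 3.5 (ii) for `F = C` — PROVED over EVERY base `D → D₀` whose split monomorphisms are
invertible** (strictly weaker than Example 3.3's «totally epimorphic»; the «⇒» half is abc-iut-w4-d092's
`NonIso.isIsoSubanchor_of_not_isotropic`, which needs no hypothesis on `D`).
[cite: MochizukiFrdII2008, Prop 3.5 (ii) p.34] -/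
theorem prop35ii_C_of_splitMono (hD : ∀ ⦃a b : D⦄ (s : a ⟶ b), IsSplitMono s → IsIso s) :
    Literature.AlgebraicGeometry.Frobenioids.ArchFrd.Prop35ii_C π := by
  intro hRC X
  constructor
  · intro hX
    exact NonIso.isIsoSubanchor_of_not_isotropic π hRC X (fun h => hX ((Ex33ii_isotropic_iff_holds π X).2 h))
  · exact isoSubanchor_not_isotropic_C_of_splitMono π hD X

/-! ### `F = A` -/

namespace A

/-- Irreducibility in `A` of the prime-degree Frobenius arrows (factorisations in `A` are factorisations in
`C`; adapted from `ArchFrd.A.isIrreducibleHom_frobHom`). [cite: MochizukiFrdII2008, Prop 3.5 (ii) p.34] -/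
theorem isIrreducibleHom_frobHom_of_splitMono (hD : ∀ ⦃a b : D⦄ (s : a ⟶ b), IsSplitMono s → IsIso s)
    (X : A π) (hX : X.obj.fst.IsNaivelyIsotropic) (p : ℕ+) (hp : (p : ℕ).Prime) :
    IsIrreducibleHom (frobHom π X p) := by
  refine ⟨fun hi => ?_, fun W β α h => ?_⟩
  · haveI := hi
    haveI : IsIso ((A.ι π).map (frobHom π X p)) := inferInstance
    exact not_isIso_frobHom π X.obj p (fun h1 => hp.ne_one (by rw [h1]; rfl))
      (this : IsIso (ArchFrd.frobHom π X.obj p))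
  · have h' : β.1 ≫ α.1 = ArchFrd.frobHom π X.obj p := congrArg (fun k => k.1) h
    rcases isIso_or_isIso_of_fac_frobHom_of_splitMono π hD hX p hp β.1 α.1 h' with hα | hβ
    · haveI := hα; exact Or.inl (isIso_of_isIso_val π α)
    · haveI := hβ; exact Or.inr (isIso_of_isIso_val π β)

/-- **[FrdI] Prop. 1.10 (iv) for `A`** over a base whose split monomorphisms are invertible (adapted from
`ArchFrd.A.not_isAnchor_of_isotropic`). [cite: MochizukiFrdII2008, Prop 3.5 (ii) p.34] -/
theorem not_isAnchor_of_isotropic_of_splitMono (hD : ∀ ⦃a b : D⦄ (s : a ⟶ b), IsSplitMono s → IsIso s)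
    (X : A π) (hX : X.obj.fst.IsNaivelyIsotropic) : ¬ IsAnchor X := by
  intro hfin
  let P : ℕ → ℕ+ := fun n => ⟨Nat.nth Nat.Prime n, (Nat.prime_nth_prime n).pos⟩
  have hP : ∀ n, ((P n : ℕ+) : ℕ).Prime := fun n => Nat.prime_nth_prime n
  let g : ℕ → Quotient (isIsomorphicSetoid (Under X)) :=
    fun n => Quotient.mk _ (Under.mk (frobHom π X (P n)))
  have hg : Function.Injective g := by
    intro m n hmn
    obtain ⟨e⟩ := Quotient.exact hmn
    have hPmn : P m = P n := eq_of_under_iso_A π X (hP m) (hP n) e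
    have : Nat.nth Nat.Prime m = Nat.nth Nat.Prime n := congrArg (fun k : ℕ+ => (k : ℕ)) hPmn
    exact Nat.nth_injective Nat.infinite_setOf_prime this
  refine Set.infinite_of_injective_forall_mem hg (fun n => ?_) hfin
  exact ⟨Under.mk (frobHom π X (P n)), isIrreducibleHom_frobHom_of_splitMono π hD X hX (P n) (hP n), rfl⟩

/-- **[FrdI] Rmk. 3.1.1 for `A`** over such a base. [cite: MochizukiFrdII2008, Prop 3.5 (ii) p.34] -/
theorem not_isNaivelyIsotropic_of_isIsoSubanchor_of_splitMono
    (hD : ∀ ⦃a b : D⦄ (s : a ⟶ b), IsSplitMono s → IsIso s) (X : A π) (h : IsIsoSubanchor X) :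
    ¬ X.obj.fst.IsNaivelyIsotropic := by
  obtain ⟨B, G, f, ⟨B', hB', ⟨g⟩⟩, hf⟩ := h
  intro hX
  have hB : B.obj.fst.IsNaivelyIsotropic := isNaivelyIsotropic_of_monoMinimalQuotient π G f hf hX
  exact not_isAnchor_of_isotropic_of_splitMono π hD B' (C0.isNaivelyIsotropic_of_hom g.1.fst hB) hB'

end A

/-- Prop. 3.5 (ii) for `A`, direction «iso-subanchor ⇒ non-isotropic», over a base whose split
monomorphisms are invertible. [cite: MochizukiFrdII2008, Prop 3.5 (ii) p.34] -/
theorem isoSubanchor_not_isotropic_A_of_splitMono (hD : ∀ ⦃a b : D⦄ (s : a ⟶ b), IsSplitMono s → IsIso s)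
    (X : A π) (h : IsIsoSubanchor X) : ¬ PreFrobenioid.IsIsotropic (A.toElem π) X :=
  fun hX => A.not_isNaivelyIsotropic_of_isIsoSubanchor_of_splitMono π hD X h
    ((Ex33ii_isotropic_iff_holds π X.obj).1 ((Ex33iii_isotropic_iff_holds π X).1 hX))

/-- **Proposition 3.5 (ii) for `F = A` — PROVED over EVERY base `D → D₀` whose split monomorphisms are
invertible.** [cite: MochizukiFrdII2008, Prop 3.5 (ii) p.34] -/
theorem prop35ii_A_of_splitMono (hD : ∀ ⦃a b : D⦄ (s : a ⟶ b), IsSplitMono s → IsIso s) :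
    Literature.AlgebraicGeometry.Frobenioids.ArchFrd.Prop35ii_A π := by
  intro hRC X
  constructor
  · intro hX
    exact NonIso.A.isIsoSubanchor_of_not_isotropic π hRC X
      (fun h => hX ((Ex33iii_isotropic_iff_holds π X).2 ((Ex33ii_isotropic_iff_holds π X.obj).2 h)))
  · exact isoSubanchor_not_isotropic_A_of_splitMono π hD X

/-- The totally epimorphic case is recovered (= `ArchFrd.prop35ii_C`, `ArchFrd.prop35ii_A`).
[cite: MochizukiFrdII2008, Prop 3.5 (ii) p.34] -/
theorem prop35ii_C_and_A_of_isTotallyEpimorphic' (hTE : IsTotallyEpimorphic D) :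
    Literature.AlgebraicGeometry.Frobenioids.ArchFrd.Prop35ii_C π ∧
      Literature.AlgebraicGeometry.Frobenioids.ArchFrd.Prop35ii_A π :=
  ⟨prop35ii_C_of_splitMono π (splitMono_isIso_of_isTotallyEpimorphic hTE),
    prop35ii_A_of_splitMono π (splitMono_isIso_of_isTotallyEpimorphic hTE)⟩

/-! ### Sharpness -/

/-- **DICHOTOMY (FACT-LIST F-0861/F-0862, exact dependence on the base).** (1) Over every base `D → D₀`
whose split monomorphisms are invertible, both typed instances of [FrdII] Prop. 3.5 (ii) hold; (2) there is
a connected base of RC-iso-subanchor type with a split monomorphism that is NOT invertible over which BOTH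
fail (the toy base `T`, seat abc-iut-f-014). [cite: MochizukiFrdII2008, Prop 3.5 (ii) p.34] -/
theorem prop35ii_splitMono_dichotomy :
    (∀ (D : Type u) [Category.{v} D] (π : D ⥤ D0),
        (∀ ⦃a b : D⦄ (s : a ⟶ b), IsSplitMono s → IsIso s) →
          Literature.AlgebraicGeometry.Frobenioids.ArchFrd.Prop35ii_C π ∧
            Literature.AlgebraicGeometry.Frobenioids.ArchFrd.Prop35ii_A π) ∧
      ∃ (D : Type) (_ : Category.{0} D) (π : D ⥤ D0) (a b : D) (s : a ⟶ b),
        IsGraphConnected D ∧ RC.IsOfRCIsoSubanchorType (baseRC π) ∧ IsSplitMono s ∧ ¬ IsIso s ∧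
          ¬ Literature.AlgebraicGeometry.Frobenioids.ArchFrd.Prop35ii_C π ∧
            ¬ Literature.AlgebraicGeometry.Frobenioids.ArchFrd.Prop35ii_A π :=
  ⟨fun _ _ π hD => ⟨prop35ii_C_of_splitMono π hD, prop35ii_A_of_splitMono π hD⟩,
    ⟨P35iiToy.T, inferInstance, P35iiToy.toD0, P35iiToy.T.p, P35iiToy.T.e, P35iiToy.T.sec false,
      P35iiToy.T.isGraphConnected, P35iiToy.isOfRCIsoSubanchorType_toD0, P35iiToy.T.isSplitMono_sec false,
      P35iiToy.T.not_isIso_sec false, P35iiToy.not_prop35ii_C, P35iiToy.not_prop35ii_A⟩⟩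

end ArchFrd

end

end Literature.AlgebraicGeometry.Frobenioids
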